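import Literature.Probability.Percolation.AdjTipData
import Literature.Probability.Percolation.AdjLaneCutUniv
import HarnessLib

/-!
# Routing the four corridors of the adjacent outer landing

Topic `Literature/Probability/Percolation`; family `crit-perc` / near-critical percolation on `𝕋`.
A brick of the near-critical arm-separation theorem for four arms in the ADJACENT colour
arrangement (P. Nolin, EJP 13 (2008), Thm. 11, `j = 4`, `σ = BBWW` [arXiv 0711.4948: Thm. 10],
landing step, §4.4 p. 12 with Prop. 12 (i)); the adjacent twin of `ArmSeparationOutRouteFour.lean`,
in the rotation-read world (`AdjLaneObjects.lean`, chunk `sA = k₀/4`).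

From good tip data (`AdjTipData.Good`) of the four exits (`0, 1` open, `2, 3` closed) in a certified
cyclic order of their spoke keys, this file chooses the ROTATION `r < 6` and the CUT `c` from the
tips alone (`Lanes.adj_exists_cut_univ`, `AdjLaneCutUniv.lean`): in the rotated frame the exits
`0, 1, 2, 3` read in this order from the cut, which lies in the block of the side `5`, so that the
targets — one candidate row per ACTUAL side off the danger zones of the spokes of that side
(`exists_tgt`), placed on the sides `0, 1` (open) and `3, 4` (closed) of the rotated frame — read
`0, 1, 2, 3` as well (`targets_read_of_window`); the matching exit `e` → target `e` and the levels
`Lanes.laneLevel` give the ring roads; on every ring the hull of the exit's own spoke window and target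
window read from the cut position avoids the spoke windows of the other colour's exits of higher
level and the approach windows of those of lower level (`excl`, by `Lanes.lanes_linear` and
`RingObj.rot_linPos_lt_of_cyc_lt`).

* `AdjTipData.TgtOK`, `exists_tgt` — targets off the danger zones, per actual side;
* `AdjTipData.Route` (`r`, `c`), `Route.Good`, `exists_route`;
* the objects `X a` (spoke of the exit `a`, rotated side), `Y e` (target of the side `ts e`),
  `C` (the cut: three chunks above the spoke of the last closed exit), their ranges, comparability
  with the cut and separation; `Tq_ne_Gq`; `hull_facts`; **`excl`**.

Everything here is proved; no named facts are introduced.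

## References

* P. Nolin, Near-critical percolation in two dimensions, *Electron. J. Probab.* 13 (2008), §4.3
  Prop. 12 (i), Lemma 13, §4.4 (arXiv 0711.4948: Prop. 11, Lemma 12; proof of Thm. 10, p. 12) [Nolin2008].
* H. Kesten, Scaling relations for 2D-percolation, *Comm. Math. Phys.* 109 (1987), Lemmas 4–6 [Kesten1987].
-/

namespace Literature.Probability.Percolation

open Lanes

namespace AdjTipData

variable (P : OParams) (D : AdjTipData)

/-! ### Targets off the danger zones, per actual side -/

/-- **Targets off the danger zones**: the candidate row chosen for the ACTUAL side `s < 6` is more than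
`μ + 8 sA` below, or its approach rows end more than `μ + 8 sA` below, the spoke of every exit of that
side. [folklore] -/
structure TgtOK (tc : ℕ → ℕ) : Prop where
  /-- every exit of the side is off the danger zone of the target of the side -/
  out : ∀ a, D.ξ P a + P.μ + 8 * P.sA < P.tgtRow4 (tc (D.i a)) ∨
    P.tgtRow4 (tc (D.i a)) + (P.N' / 64 : ℕ) + P.μ + 8 * P.sA < D.ξ P a

variable {P D}

/-- **The targets can be chosen off the danger zones**: each of the at most four exits of a side
excludes at most one of the five candidate rows. [folklore] -/
theorem exists_tgt (D : AdjTipData) : ∃ tc : ℕ → ℕ, (∀ s, tc s < 5) ∧ D.TgtOK P tc := by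
  classical
  have hsp : (P.sp : ℤ) = (P.N' / 64 : ℕ) + 2 * P.μ + 16 * P.s + 1 := by unfold OParams.sp; push_cast; ring
  have hsA : (P.sA : ℤ) ≤ P.s := by
    have : P.sA ≤ P.k₀ := Nat.div_le_self _ _
    have hs : P.s = P.k₀ := rfl
    rw [hs]; exact_mod_cast this
  have hex : ∀ s : ℕ, ∃ c, c < 5 ∧ ∀ a, D.i a = s →
      D.ξ P a + P.μ + 8 * P.sA < P.tgtRow4 c ∨ P.tgtRow4 c + (P.N' / 64 : ℕ) + P.μ + 8 * P.sA < D.ξ P a := by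
    intro s
    let bad : Fin 4 → Finset ℕ := fun a => (Finset.range 5).filter fun c =>
      ¬ (D.ξ P a + P.μ + 8 * P.sA < P.tgtRow4 c ∨ P.tgtRow4 c + (P.N' / 64 : ℕ) + P.μ + 8 * P.sA < D.ξ P a)
    have hbad : ∀ a, (bad a).card ≤ 1 := by
      intro a
      refine Finset.card_le_one.2 fun c hc c' hc' => ?_
      simp only [bad, Finset.mem_filter, Finset.mem_range, not_or, not_lt] at hc hc'
      have e1 : P.tgtRow4 c = otgtRow P.N' false + c * P.sp := rfl
      have e2 : P.tgtRow4 c' = otgtRow P.N' false + c' * P.sp := rfl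
      by_contra hne
      have hsp0 : (0 : ℤ) ≤ P.sp := by positivity
      have hsA0 : (0 : ℤ) ≤ P.sA := by positivity
      rcases Nat.lt_or_gt_of_ne hne with h | h
      · have : (c : ℤ) + 1 ≤ c' := by exact_mod_cast h
        nlinarith [hc.2.1, hc.2.2, hc'.2.1, hc'.2.2]
      · have : (c' : ℤ) + 1 ≤ c := by exact_mod_cast h
        nlinarith [hc.2.1, hc.2.2, hc'.2.1, hc'.2.2]
    have hU : (Finset.univ.biUnion bad).card < (Finset.range 5).card := by
      calc (Finset.univ.biUnion bad).card ≤ ∑ a, (bad a).card := Finset.card_biUnion_le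
        _ ≤ ∑ _a : Fin 4, 1 := Finset.sum_le_sum fun a _ => hbad a
        _ < (Finset.range 5).card := by simp
    have hsub : ¬ Finset.range 5 ⊆ Finset.univ.biUnion bad := fun h =>
      absurd (Finset.card_le_card h) (not_le.2 hU)
    rw [Finset.not_subset] at hsub
    obtain ⟨c, hc, hcU⟩ := hsub
    refine ⟨c, Finset.mem_range.1 hc, fun a _ => ?_⟩
    by_contra hno
    exact hcU (Finset.mem_biUnion.2 ⟨a, Finset.mem_univ _, Finset.mem_filter.2 ⟨hc, hno⟩⟩)
  choose tc htc htgt using hex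
  exact ⟨tc, htc, ⟨fun a => htgt (D.i a) a rfl⟩⟩

/-! ### The routing certificate -/

/-- the landing sides of the rotated frame: `0, 1` (open), `3, 4` (closed) [folklore] -/
def ts (e : Fin 4) : ℕ := if (e : ℕ) < 2 then (e : ℕ) else (e : ℕ) + 1

/-- The landing sides are `< 6`. [folklore] -/
theorem ts_lt (e : Fin 4) : ts e < 6 := by unfold ts; have := e.isLt; split_ifs <;> omega

/-- The landing sides, listed. [folklore] -/
theorem ts_val : ts 0 = 0 ∧ ts 1 = 1 ∧ ts 2 = 3 ∧ ts 3 = 4 := by unfold ts; decide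

/-- Distinct arms land on distinct sides. [folklore] -/
theorem ts_ne {e e' : Fin 4} (h : e ≠ e') : ts e ≠ ts e' := by
  intro h'
  apply h
  have he := e.isLt; have he' := e'.isLt
  apply Fin.ext
  unfold ts at h'
  split_ifs at h' <;> omega

/-- The landing sides increase. [folklore] -/
theorem ts_lt_ts {e e' : Fin 4} (h : e < e') : ts e < ts e' := by
  have h' : (e : ℕ) < e' := h
  have he := e.isLt; have he' := e'.isLt
  unfold ts; split_ifs <;> omega

/-- **A routing certificate**: the rotation `r` and the cut key `c` (in the rotated frame). [folklore] -/
structure Route where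
  /-- the rotation -/
  r : ℕ
  /-- the cut key -/
  c : ℤ

variable (P D) (tc : ℕ → ℕ) (R : Route)

/-- the side of the exit `a` in the rotated frame [folklore] -/
def Route.i' (a : Fin 4) : ℕ := (D.i a + 6 - R.r) % 6
/-- the spoke key of the exit `a` in the rotated frame [folklore] -/
def κ' (a : Fin 4) : ℤ := rotKey P.M (R.i' D a) (D.ξ P a)
/-- the actual side carrying the target of the landing side `e` [folklore] -/
def Route.as (e : Fin 4) : ℕ := (ts e + R.r) % 6
/-- the target row of the landing side `e` [folklore] -/
def tr (e : Fin 4) : ℤ := P.tgtRow4 (tc (R.as e))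
/-- the target key of the landing side `e` (rotated frame) [folklore] -/
def γ (e : Fin 4) : ℤ := rotKey P.M (ts e) (tr P tc R e)
/-- the exits, read from the cut [folklore] -/
def Tq (a : Fin 4) : ℤ := cyc (12 * P.M) R.c (κ' P D R a)
/-- the targets, read from the cut [folklore] -/
def Gq (e : Fin 4) : ℤ := cyc (12 * P.M) R.c (γ P tc R e)
/-- the level of the ring road of the exit / landing side `e` [folklore] -/
def lv (e : Fin 4) : ℕ := laneLevel (Tq P D R) (Gq P tc R) e
/-- the side `i` of the frame `ρ^r`, read after `δ` more rotations [folklore] -/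
def sft (δ i : ℕ) : ℕ := (i + 6 - δ % 6) % 6

/-- Read sides are `< 6`. [folklore] -/
theorem sft_lt (δ i : ℕ) : sft δ i < 6 := Nat.mod_lt _ (by norm_num)

/-- Reading sides is injective on sides. [folklore] -/
theorem sft_inj {δ i j : ℕ} (hi : i < 6) (hj : j < 6) : sft δ i = sft δ j ↔ i = j := by
  unfold sft; have := Nat.mod_lt δ (show 0 < 6 by norm_num); constructor <;> intro h <;> omega

/-- The key of a read side is the shifted key. [folklore] -/
theorem rotKey_sft {M δ i : ℕ} (hi : i < 6) {ζ : ℤ} (hζ : -(2 * (M : ℤ)) ≤ ζ ∧ ζ < 0) :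
    rotKey M (sft δ i) ζ = shd M (2 * M * (δ % 6)) (rotKey M i ζ) :=
  rotKey_rot hi (Nat.mod_lt _ (by norm_num)) hζ

/-- the cut row: three chunks above the spoke of the last closed exit `3` [folklore] -/
def ρC : ℤ := D.ξ P 3 + 3 * P.sA
/-- the cut object (on the rotated side of the exit `3`) [folklore] -/
def C (δ : ℕ) : RingObj := ⟨sft δ (R.i' D 3), ρC P D, ρC P D⟩
/-- the spoke object of the exit `a` (rotated side; the spoke row and one chunk below it — on the
diagonal sides a radial spoke smears over the ring band by up to a chunk) [folklore] -/
def X (δ : ℕ) (a : Fin 4) : RingObj := ⟨sft δ (R.i' D a), D.ξ P a - P.sA, D.ξ P a⟩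
/-- the target object of the landing side `e` (approach rows and exit run, one chunk of margin below) [folklore] -/
def Y (δ : ℕ) (e : Fin 4) : RingObj := ⟨sft δ (ts e), tr P tc R e - P.sA, tr P tc R e + ((P.dA - 1 : ℕ) : ℤ) * P.sA⟩
/-- chunks per side of the ring of `e` [folklore] -/
def nE (e : Fin 4) : ℕ := P.nA (lv P D tc R e)
/-- radius of the ring of `e` [folklore] -/
def rE (e : Fin 4) : ℕ := P.rL (lv P D tc R e)
/-- tubes of the ring of `e` [folklore] -/
def GE (e : Fin 4) : ℕ := P.GrA (lv P D tc R e)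
/-- the cut position on the ring of `e` [folklore] -/
def pc (δ : ℕ) (e : Fin 4) : ℕ := (C P D R δ).rcutPos (nE P D tc R e) P.sA (rE P D tc R e)
/-- read position on the ring of `e` [folklore] -/
def lp (δ : ℕ) (e : Fin 4) (p : ℕ) : ℕ := linPos (GE P D tc R e) (pc P D tc R δ e) p
/-- start of the hull of `e` (read position) [folklore] -/
def hs (δ : ℕ) (e : Fin 4) : ℕ :=
  min (lp P D tc R δ e ((X P D R δ e).rwlo (nE P D tc R e) P.sA (rE P D tc R e)))
    (lp P D tc R δ e ((Y P tc R δ e).rwlo (nE P D tc R e) P.sA (rE P D tc R e)))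
/-- end of the hull of `e` (read position) [folklore] -/
def he (δ : ℕ) (e : Fin 4) : ℕ :=
  max (lp P D tc R δ e ((X P D R δ e).rwhi (nE P D tc R e) P.sA (rE P D tc R e)))
    (lp P D tc R δ e ((Y P tc R δ e).rwhi (nE P D tc R e) P.sA (rE P D tc R e)))
/-- start of the arc of `e` (absolute position) [folklore] -/
def astAbs (δ : ℕ) (e : Fin 4) : ℕ := (pc P D tc R δ e + hs P D tc R δ e) % GE P D tc R e
/-- length of the arc of `e` [folklore] -/
def alnE (δ : ℕ) (e : Fin 4) : ℕ := he P D tc R δ e - hs P D tc R δ e + 1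

/-- **A good routing certificate** (what `Lanes.adj_exists_cut_univ` provides): the rotation is `< 6`,
the cut key is the key of the cut row on the rotated side of the exit `3`, it lies in the block of
the side `5` with its margins (`R = 4M/16`), and the exits read `0, 1, 2, 3` from it, each at least
three chunks after it. [folklore] -/
structure Route.Good : Prop where
  /-- the rotation -/
  hr : R.r < 6
  /-- the cut key is the key of the cut row -/
  hc : R.c = rotKey P.M (R.i' D 3) (ρC P D)
  /-- range of the cut key -/
  hc_range : 0 ≤ R.c ∧ R.c < 12 * P.M
  /-- the cut lies in the window of the side `5` -/
  hwin : 10 * (P.M : ℤ) - (4 * P.M / 16 : ℕ) + 3 * P.sA ≤ R.c ∧ R.c < 12 * (P.M : ℤ) - (4 * P.M / 16 : ℕ) + 3 * P.sA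
  /-- the exits read increasingly -/
  hτ : Tq P D R 0 < Tq P D R 1 ∧ Tq P D R 1 < Tq P D R 2 ∧ Tq P D R 2 < Tq P D R 3
  /-- exits off the cut -/
  hfarτ : ∀ a, 3 * (P.sA : ℤ) ≤ Tq P D R a

variable {P D tc R} {δ : ℕ}

/-- Strict monotonicity on `Fin 4` from the three consecutive inequalities. [folklore] -/
theorem strictMono_four' {f : Fin 4 → ℤ} (h0 : f 0 < f 1) (h1 : f 1 < f 2) (h2 : f 2 < f 3) : StrictMono f :=
  Fin.strictMono_iff_lt_succ.2 fun i => by fin_cases i <;> assumption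

/-- The rotated sides are `< 6`. [folklore] -/
theorem Route.i'_lt (R : Route) (D : AdjTipData) (a : Fin 4) : R.i' D a < 6 := Nat.mod_lt _ (by norm_num)

/-- Rotated sides agree iff the sides agree. [folklore] -/
theorem Route.i'_eq_iff {R : Route} {D : AdjTipData} (hr : R.r < 6) (hi : ∀ a, D.i a < 6) {a b : Fin 4} :
    R.i' D a = R.i' D b ↔ D.i a = D.i b := by
  unfold Route.i'
  have ha := hi a; have hb := hi b
  constructor <;> intro h <;> omega

/-- The actual target side of `e` read in the rotated frame is `ts e`. [folklore] -/
theorem Route.i'_of_as {R : Route} {D : AdjTipData} (hr : R.r < 6) {a : Fin 4} {e : Fin 4} (h : D.i a = R.as e) :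
    R.i' D a = ts e := by
  unfold Route.i'; unfold Route.as at h
  have := ts_lt e
  rw [h]; omega

/-- **The spoke key in the rotated frame is the shifted spoke key.** [folklore] -/
theorem κ'_eq (hV : P.ValidA) (hD : D.Good P) (hr : R.r < 6) (a : Fin 4) :
    κ' P D R a = shd P.M (2 * P.M * R.r) (D.κ P a) := by
  obtain ⟨-, -, hlo, hhi, -⟩ := hD.obj_ok hV le_rfl a
  change -(2 * (P.M : ℤ)) + 2 * P.sA ≤ D.ξ P a at hlo
  change D.ξ P a + 2 * P.ε + 4 * P.sA < 0 at hhi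
  have hs : (0 : ℤ) ≤ P.sA := by positivity
  have hε : (0 : ℤ) ≤ P.ε := by positivity
  unfold κ' κ Route.i'
  exact rotKey_rot (hD.hi a) hr ⟨by linarith, by linarith⟩

/-- **Target facts**: the target rows lie in the middle landing band `[-2M + 4M/16, -M - 4M/16]`, the
target object's rows cover the approach rows, everything is a middle row, and the target keys lie in
their blocks. [folklore] -/
theorem tgt_facts (hV : P.ValidA) (htc : ∀ s, tc s < 5) (e : Fin 4) :
    -(2 * (P.M : ℤ)) + (4 * P.M / 16 : ℕ) ≤ tr P tc R e ∧ tr P tc R e ≤ -(P.M : ℤ) - (4 * P.M / 16 : ℕ) ∧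
      ((P.N' / 64 : ℕ) : ℤ) ≤ ((P.dA - 1 : ℕ) : ℤ) * P.sA ∧ ((P.dA - 1 : ℕ) : ℤ) * P.sA ≤ (P.N' / 64 : ℕ) + 2 * P.sA ∧
      -(2 * (P.M : ℤ)) + 7 * P.sA ≤ tr P tc R e ∧ tr P tc R e + ((P.dA - 1 : ℕ) : ℤ) * P.sA + 7 * P.sA ≤ 0 ∧
      2 * (P.M : ℤ) * (ts e) + 7 * P.sA ≤ γ P tc R e ∧ γ P tc R e + 7 * P.sA ≤ 2 * (P.M : ℤ) * (ts e + 1) ∧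
      3 * (P.sA : ℤ) ≤ (4 * P.M / 16 : ℕ) := by
  obtain ⟨-, hk₀, hμ, -, -, -, -, -, -, -, -, -, -, -, -, hN, -, -, -, hμM, -⟩ := hV.toValid.ifacts
  obtain ⟨t1, t2⟩ := hV.toValid.tgtRow4_mem (htc (R.as e))
  obtain ⟨hd1, hd2⟩ := hV.dA_facts
  have hsA : 4 * P.sA = P.k₀ := hV.sA_facts.1
  have hsA' : 4 * (P.sA : ℤ) = P.k₀ := by exact_mod_cast hsA
  have hN64 : ((P.N' / 64 : ℕ) : ℤ) ≤ P.M := by have : P.N' = 4 * P.M := rfl; omega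
  have h16' : 4 * ((4 * P.M / 16 : ℕ) : ℤ) ≤ P.M := by omega
  have h16'' : (P.M : ℤ) ≤ 4 * ((4 * P.M / 16 : ℕ) : ℤ) + 4 := by omega
  have ht1 : -(2 * (P.M : ℤ)) + 7 * P.sA ≤ tr P tc R e := by unfold tr; linarith
  have ht2 : tr P tc R e + ((P.dA - 1 : ℕ) : ℤ) * P.sA + 7 * P.sA ≤ 0 := by unfold tr; nlinarith
  refine ⟨t1, t2, hd1, hd2, ht1, ht2, ?_, ?_, by omega⟩
  · unfold γ rotKey; linarith
  · unfold γ rotKey; nlinarith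

/-- **The targets read increasingly from a good cut**, each at least three chunks after it. [folklore] -/
theorem Route.Good.hγ (hV : P.ValidA) (htc : ∀ s, tc s < 5) (hR : R.Good P D) :
    (Gq P tc R 0 < Gq P tc R 1 ∧ Gq P tc R 1 < Gq P tc R 2 ∧ Gq P tc R 2 < Gq P tc R 3) ∧
      ∀ e, 3 * (P.sA : ℤ) ≤ Gq P tc R e := by
  have h := fun e => tgt_facts (R := R) hV htc e
  have hsA1 : 1 ≤ P.sA := by have := hV.sA_facts.2; omega
  obtain ⟨-, -, -, -, -, -, -, -, hRs⟩ := h 0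
  have hw := targets_read_of_window (M := P.M) (s := P.sA) (R := 4 * P.M / 16) hsA1 (by exact_mod_cast hRs) hR.hwin
    (ρ := fun e => tr P tc R e) (fun e => ⟨(h e).1, by have h1 := (h e).2.1; have h2 : (0 : ℤ) ≤ P.M := (by positivity); linarith⟩)
  obtain ⟨⟨w1, w2, w3⟩, f0, f1, f2, f3⟩ := hw
  have e0 : Gq P tc R 0 = cyc (12 * P.M) R.c (rotKey P.M 0 (tr P tc R 0)) := by unfold Gq γ; rw [ts_val.1]
  have e1 : Gq P tc R 1 = cyc (12 * P.M) R.c (rotKey P.M 1 (tr P tc R 1)) := by unfold Gq γ; rw [ts_val.2.1]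
  have e2 : Gq P tc R 2 = cyc (12 * P.M) R.c (rotKey P.M 3 (tr P tc R 2)) := by unfold Gq γ; rw [ts_val.2.2.1]
  have e3 : Gq P tc R 3 = cyc (12 * P.M) R.c (rotKey P.M 4 (tr P tc R 3)) := by unfold Gq γ; rw [ts_val.2.2.2]
  refine ⟨⟨by rw [e0, e1]; exact w1, by rw [e1, e2]; exact w2, by rw [e2, e3]; exact w3⟩, fun e => ?_⟩
  fin_cases e
  · show 3 * (P.sA : ℤ) ≤ Gq P tc R 0; rw [e0]; exact f0
  · show 3 * (P.sA : ℤ) ≤ Gq P tc R 1; rw [e1]; exact f1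
  · show 3 * (P.sA : ℤ) ≤ Gq P tc R 2; rw [e2]; exact f2
  · show 3 * (P.sA : ℤ) ≤ Gq P tc R 3; rw [e3]; exact f3

/-- The spoke row of every exit is far below the top of its side: `ξ + μ ≤ 0` (indeed `ξ ≤ -R₀ + 2k`). [folklore] -/
theorem Good.ξ_top (hV : P.ValidA) (hD : D.Good P) (a : Fin 4) : D.ξ P a + P.μ ≤ 0 := by
  obtain ⟨ka1, kμ, hsA, hw1, hε1, hk₀, fa1, fa2, hξa, za1, za2, g1, g2, hR₀, hR₀M⟩ := hD.facts hV a
  have hζa := D.ζ_eq (P := P) a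
  cases hua : D.up a
  · have e1 := hζa.1 hua; omega
  · have e1 := hζa.2 hua; omega

/-- Shifting commutes with a translation that stays inside one block. [folklore] -/
theorem shd_add_of_block {M r i : ℕ} (hr : r < 6) (hi : i < 6) {x e : ℤ} (hx : 2 * (M : ℤ) * i ≤ x)
    (hxe : x + e < 2 * (M : ℤ) * (i + 1)) (he : 0 ≤ e) :
    shd M (2 * M * r) (x + e) = shd M (2 * M * r) x + e := by
  unfold shd
  interval_cases r <;> interval_cases i <;> push_cast at hx hxe ⊢ <;> split_ifs <;> omega

/-- **The routing certificate exists** (spoke keys in the certified cyclic order `0, 1, 2, 3`). [cite: Nolin2008, §4.3 Prop. 12 (i), §4.4 p. 12 (arXiv 0711.4948: Prop. 11; relocation of landing areas)] -/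
theorem exists_route (hV : P.ValidA) (hD : D.Good P)
    (hchain : cyc (12 * P.M) (D.κ P 0) (D.κ P 1) < cyc (12 * P.M) (D.κ P 0) (D.κ P 2) ∧
      cyc (12 * P.M) (D.κ P 0) (D.κ P 2) < cyc (12 * P.M) (D.κ P 0) (D.κ P 3)) :
    ∃ R : Route, R.Good P D := by
  have hsA16 := hV.sA_facts.2
  have hsA1 : 1 ≤ P.sA := by omega
  obtain ⟨-, hk₀, hμ, -, -, -, -, -, -, -, -, -, -, -, -, hN, -, -, -, hμM, -⟩ := hV.toValid.ifacts
  have hM1 : 1 ≤ P.M := by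
    have : 64 * P.μ ≤ P.M := hV.toValid.hμM
    have : P.k₀ ≤ P.μ := le_trapScale P.k₀ P.K
    have := hV.toValid.hk₀; omega
  have hκ := fun a => hD.κ_range hV a
  have hfar := hD.κ_far hV (show (0 : Fin 4) ≠ 1 by decide)
  have hfar30 := hD.κ_far hV (show (3 : Fin 4) ≠ 0 by decide)
  have hε : (0 : ℤ) ≤ P.ε := by positivity
  have hκ0 := hκ 0; have hκ1 := hκ 1; have hκ3 := hκ 3
  have h01 : 0 < cyc (12 * P.M) (D.κ P 0) (D.κ P 1) := by
    rw [cyc_eq_ite]; rcases hfar with h | h <;> split_ifs <;> omega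
  have hgap : 6 * (P.sA : ℤ) ≤ cyc (12 * P.M) (D.κ P 3) (D.κ P 0) := by
    obtain ⟨m0, M0⟩ := hD.κ_mem hV 0
    obtain ⟨m3, M3⟩ := hD.κ_mem hV 3
    have hi0 : (0 : ℤ) ≤ D.i 0 := by positivity
    have hi3 : (D.i 3 : ℤ) ≤ 5 := by have := hD.hi 3; omega
    have hM : (0 : ℤ) ≤ P.M := by positivity
    have hup : 2 * (P.M : ℤ) * (D.i 3 + 1) ≤ 12 * P.M := by nlinarith
    have hp : 0 ≤ 2 * (P.M : ℤ) * (D.i 0) := by positivity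
    rw [cyc_eq_ite]; rcases hfar30 with h | h <;> split_ifs <;> omega
  have hRs : 3 * P.sA ≤ 4 * P.M / 16 := by
    have : 4 * P.sA = P.k₀ := hV.sA_facts.1
    have : P.k₀ ≤ P.μ := le_trapScale P.k₀ P.K
    have := hV.toValid.hμM; omega
  have hR2 : 4 * P.M / 16 ≤ 2 * P.M := by omega
  obtain ⟨r, hr6, c, hc0, hc1, hord, hfarτ, hwin, hcf⟩ :=
    adj_exists_cut_univ (M := P.M) (s := P.sA) (R := 4 * P.M / 16) hM1 hsA1 hRs hR2 hκ hchain h01 hgap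
  set R : Route := ⟨r, c⟩ with hRdef
  have hκ' : ∀ a, κ' P D R a = shd P.M (2 * P.M * r) (D.κ P a) := fun a => κ'_eq (R := R) hV hD hr6 a
  refine ⟨R, hr6, ?_, ⟨hc0, hc1⟩, ⟨by exact_mod_cast hwin.1, by exact_mod_cast hwin.2⟩, ?_, fun a => ?_⟩
  · -- the cut key is the key of the cut row `ξ 3 + 3 sA` on the rotated side of the exit `3`
    have e3 : rotKey P.M (R.i' D 3) (ρC P D) = κ' P D R 3 + 3 * P.sA := by unfold κ' rotKey ρC; ring
    rw [e3, hκ' 3]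
    show c = _
    rw [hcf]
    obtain ⟨m3, M3⟩ := hD.κ_mem hV 3
    have hi3 : (D.i 3 : ℤ) ≤ 5 := by have := hD.hi 3; omega
    have hM : (0 : ℤ) ≤ P.M := by positivity
    have htop : D.κ P 3 + 3 * P.sA < 12 * P.M := by nlinarith
    rw [if_pos htop]
    exact shd_add_of_block hr6 (hD.hi 3) (by linarith) (by linarith) (by positivity)
  · rw [show Tq P D R 0 = cyc (12 * P.M) c (κ' P D R 0) from rfl, show Tq P D R 1 = cyc (12 * P.M) c (κ' P D R 1) from rfl,
      show Tq P D R 2 = cyc (12 * P.M) c (κ' P D R 2) from rfl, show Tq P D R 3 = cyc (12 * P.M) c (κ' P D R 3) from rfl,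
      hκ' 0, hκ' 1, hκ' 2, hκ' 3]
    exact hord
  · show 3 * (P.sA : ℤ) ≤ cyc (12 * P.M) c (κ' P D R a)
    rw [hκ' a]; exact hfarτ a

/-! ### The objects on the rings -/

/-- **Ring facts of the exit `e`**: chunks, radius, tubes, level. [folklore] -/
theorem ringE_facts (hV : P.ValidA) (e : Fin 4) :
    1 ≤ nE P D tc R e ∧ ((nE P D tc R e : ℕ) : ℤ) * P.sA = rE P D tc R e ∧ 2 * P.M ≤ rE P D tc R e ∧
      GE P D tc R e = 12 * nE P D tc R e - 4 ∧ lv P D tc R e < 8 ∧ 1 ≤ P.sA := by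
  have hlv : lv P D tc R e < 8 := laneLevel_lt _ _ _
  obtain ⟨-, h2, h3, h4, h5⟩ := hV.ringA_facts hlv
  exact ⟨h2, h5, h3, rfl, hlv, h4⟩

/-- The cut object is in range on every ring. [folklore] -/
theorem C_ok (hV : P.ValidA) (hD : D.Good P) (e : Fin 4) : (C P D R δ).OK P.sA (rE P D tc R e) P.M := by
  obtain ⟨-, -, hlo, -, -⟩ := hD.obj_ok hV le_rfl 3
  change -(2 * (P.M : ℤ)) + 2 * P.sA ≤ D.ξ P 3 at hlo
  have htop := hD.ξ_top hV 3
  obtain ⟨ka1, kμ, hsA, -, -, hk₀, -⟩ := hD.facts hV 3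
  obtain ⟨-, -, hMr, -⟩ := ringE_facts (D := D) (tc := tc) (R := R) hV e
  have hs0 : (0 : ℤ) ≤ P.sA := by positivity
  exact ⟨sft_lt _ _, le_rfl, by show _ ≤ D.ξ P 3 + 3 * P.sA; linarith,
    by show D.ξ P 3 + 3 * P.sA + 4 * P.sA < 0; linarith, hMr⟩

/-- The spoke objects are in range on every ring. [folklore] -/
theorem X_ok (hV : P.ValidA) (hD : D.Good P) (a e : Fin 4) : (X P D R δ a).OK P.sA (rE P D tc R e) P.M := by
  obtain ⟨-, -, -, hhi, -⟩ := hD.obj_ok hV le_rfl a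
  change D.ξ P a + 2 * P.ε + 4 * P.sA < 0 at hhi
  obtain ⟨ka1, kμ, hsA, hw1, hε1, hk₀, fa1, fa2, hξa, za1, za2, g1, g2, hR₀, hR₀M⟩ := hD.facts hV a
  have hζa := D.ζ_eq (P := P) a
  obtain ⟨-, -, hMr, -⟩ := ringE_facts (D := D) (tc := tc) (R := R) hV e
  have hε : (0 : ℤ) ≤ P.ε := by positivity
  have hlo : -(2 * (P.M : ℤ)) + 2 * P.sA ≤ D.ξ P a - P.sA := by
    cases hua : D.up a
    · have e1 := hζa.1 hua; omega
    · have e1 := hζa.2 hua; omega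
  exact ⟨sft_lt _ _, by show D.ξ P a - P.sA ≤ D.ξ P a; omega, hlo, by show D.ξ P a + 4 * P.sA < 0; linarith, hMr⟩

/-- The target objects are in range on every ring. [folklore] -/
theorem Y_ok (hV : P.ValidA) (htc : ∀ s, tc s < 5) (e' e : Fin 4) : (Y P tc R δ e').OK P.sA (rE P D tc R e) P.M := by
  obtain ⟨-, -, -, -, t1, t2, -⟩ := tgt_facts (R := R) hV htc e'
  obtain ⟨-, -, hMr, -, -, hs1⟩ := ringE_facts (D := D) (tc := tc) (R := R) hV e
  have hs1' : (1 : ℤ) ≤ P.sA := by exact_mod_cast hs1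
  have hd0 : (0 : ℤ) ≤ ((P.dA - 1 : ℕ) : ℤ) * P.sA := by positivity
  exact ⟨sft_lt _ _, by show tr P tc R e' - P.sA ≤ tr P tc R e' + _; linarith, by show _ ≤ tr P tc R e' - P.sA; linarith,
    by show tr P tc R e' + _ + _ < 0; linarith, hMr⟩

/-- **Comparability from the rows**: objects on different sides, or on a common side with rows `g`
chunks apart, are comparable in the side-lexicographic order. [folklore] -/
theorem rbefore_or {g s : ℕ} {X C : RingObj} (h : X.fr ≠ C.fr ∨ X.hi + g * s ≤ C.lo ∨ C.hi + g * s ≤ X.lo) :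
    RingObj.RBefore g s X C ∨ RingObj.RBefore g s C X := by
  unfold RingObj.RBefore
  rcases lt_trichotomy X.fr C.fr with hlt | heq | hgt
  · exact Or.inl (Or.inl hlt)
  · rcases h with h | h | h
    · exact absurd heq h
    · exact Or.inl (Or.inr ⟨heq, h⟩)
    · exact Or.inr (Or.inr ⟨heq.symm, h⟩)
  · exact Or.inr (Or.inl hgt)

/-- The spoke objects are comparable with the cut (two chunks). [folklore] -/
theorem X_cut (hV : P.ValidA) (hD : D.Good P) (hR : R.Good P D) (a : Fin 4) :
    RingObj.RBefore 2 P.sA (X P D R δ a) (C P D R δ) ∨ RingObj.RBefore 2 P.sA (C P D R δ) (X P D R δ a) := by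
  apply rbefore_or
  show sft δ (R.i' D a) ≠ sft δ (R.i' D 3) ∨ D.ξ P a + 2 * P.sA ≤ ρC P D ∨ ρC P D + 2 * P.sA ≤ D.ξ P a - P.sA
  by_cases hi : D.i a = D.i 3
  · right
    unfold ρC
    have hs0 : (0 : ℤ) ≤ P.sA := by positivity
    have hε : (0 : ℤ) ≤ P.ε := by positivity
    by_cases ha : a = 3
    · subst ha; left; linarith
    · rcases lt_trichotomy (D.t a) (D.t 3) with hl | hl | hl
      · have := hD.gap hV ha hi hl; left; linarith
      · exact absurd hl (hD.htne a 3 ha hi)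
      · have := hD.gap hV (Ne.symm ha) hi.symm hl; right; linarith
  · exact Or.inl fun h => hi ((Route.i'_eq_iff hR.hr hD.hi).1 ((sft_inj (R.i'_lt D a) (R.i'_lt D 3)).1 h))

/-- The target objects are comparable with the cut (two chunks). [folklore] -/
theorem Y_cut (hV : P.ValidA) (hD : D.Good P) (hR : R.Good P D) (htc : ∀ s, tc s < 5) (htgt : D.TgtOK P tc) (e' : Fin 4) :
    RingObj.RBefore 2 P.sA (Y P tc R δ e') (C P D R δ) ∨ RingObj.RBefore 2 P.sA (C P D R δ) (Y P tc R δ e') := by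
  apply rbefore_or
  show sft δ (ts e') ≠ sft δ (R.i' D 3) ∨ tr P tc R e' + ((P.dA - 1 : ℕ) : ℤ) * P.sA + 2 * P.sA ≤ ρC P D ∨ ρC P D + 2 * P.sA ≤ tr P tc R e' - P.sA
  by_cases hi : D.i 3 = R.as e'
  · right
    unfold ρC
    have hs0 : (0 : ℤ) ≤ P.sA := by positivity
    have hμ : (0 : ℤ) ≤ P.μ := by positivity
    obtain ⟨-, -, -, hd2, -⟩ := tgt_facts (R := R) hV htc e'
    have h := htgt.out 3
    have htr : tr P tc R e' = P.tgtRow4 (tc (D.i 3)) := by unfold tr; rw [hi]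
    rw [← htr] at h
    rcases h with h' | h'
    · right; linarith
    · left; linarith
  · left
    intro h'
    have h := (sft_inj (ts_lt e') (R.i'_lt D 3)).1 h'
    apply hi
    -- `ts e' = i' 3` forces the actual side of `3` to be `as e'`
    unfold Route.i' at h; unfold Route.as
    have h3 := hD.hi 3; have hr := hR.hr; have := ts_lt e'
    omega

/-- Distinct spoke objects are separated. [folklore] -/
theorem sep_XX (hV : P.ValidA) (hD : D.Good P) (hR : R.Good P D) {a b : Fin 4} (hab : a ≠ b) :
    RingObj.Sep P.sA (X P D R δ a) (X P D R δ b) := by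
  intro hi0
  have hi : R.i' D a = R.i' D b := (sft_inj (R.i'_lt D a) (R.i'_lt D b)).1 hi0
  have hi' : D.i a = D.i b := (Route.i'_eq_iff hR.hr hD.hi).1 hi
  show D.ξ P a + 3 * P.sA ≤ D.ξ P b - P.sA ∨ D.ξ P b + 3 * P.sA ≤ D.ξ P a - P.sA
  have hs0 : (0 : ℤ) ≤ P.sA := by positivity
  have hε : (0 : ℤ) ≤ P.ε := by positivity
  rcases lt_trichotomy (D.t a) (D.t b) with hl | hl | hl
  · have := hD.gap hV hab hi' hl; left; linarith
  · exact absurd hl (hD.htne a b hab hi')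
  · have := hD.gap hV (Ne.symm hab) hi'.symm hl; right; linarith

/-- A spoke object and a target object are separated. [folklore] -/
theorem sep_XY (hV : P.ValidA) (hD : D.Good P) (hR : R.Good P D) (htc : ∀ s, tc s < 5) (htgt : D.TgtOK P tc) (a e' : Fin 4) :
    RingObj.Sep P.sA (X P D R δ a) (Y P tc R δ e') := by
  intro hi0
  have hi : R.i' D a = ts e' := (sft_inj (R.i'_lt D a) (ts_lt e')).1 hi0
  show D.ξ P a + 3 * P.sA ≤ tr P tc R e' - P.sA ∨ tr P tc R e' + ((P.dA - 1 : ℕ) : ℤ) * P.sA + 3 * P.sA ≤ D.ξ P a - P.sA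
  have hs0 : (0 : ℤ) ≤ P.sA := by positivity
  have hμ : (0 : ℤ) ≤ P.μ := by positivity
  obtain ⟨-, -, -, hd2, -⟩ := tgt_facts (R := R) hV htc e'
  have hia : D.i a = R.as e' := by
    unfold Route.i' at hi; unfold Route.as
    have h3 := hD.hi a; have hr := hR.hr; have := ts_lt e'
    omega
  have h := htgt.out a
  have htr : tr P tc R e' = P.tgtRow4 (tc (D.i a)) := by unfold tr; rw [hia]
  rw [← htr] at h
  rcases h with h' | h'
  · left; linarith
  · right; linarith

/-- Separation is symmetric. [folklore] -/
theorem rsep_symm {s : ℕ} {X Y : RingObj} (h : RingObj.Sep s X Y) : RingObj.Sep s Y X := fun hf => (h hf.symm).symm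

/-- Distinct target objects are separated (they are on distinct sides). [folklore] -/
theorem sep_YY {e e' : Fin 4} (h : e ≠ e') : RingObj.Sep P.sA (Y P tc R δ e) (Y P tc R δ e') := fun hf =>
  absurd ((sft_inj (ts_lt e) (ts_lt e')).1 hf) (ts_ne h)

/-- **A spoke key and a target key are six chunks apart** (targets off the danger zones). [folklore] -/
theorem κγ_far (hV : P.ValidA) (hD : D.Good P) (hR : R.Good P D) (htc : ∀ s, tc s < 5) (htgt : D.TgtOK P tc) (a e : Fin 4) :
    κ' P D R a + 6 * P.sA ≤ γ P tc R e ∨ γ P tc R e + 6 * P.sA ≤ κ' P D R a := by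
  have hs0 : (0 : ℤ) ≤ P.sA := by positivity
  have hμ : (0 : ℤ) ≤ P.μ := by positivity
  obtain ⟨-, -, -, hd2, -, -, g1, g2, -⟩ := tgt_facts (R := R) hV htc e
  obtain ⟨-, -, hlo, hhi, -⟩ := hD.obj_ok hV le_rfl a
  change -(2 * (P.M : ℤ)) + 2 * P.sA ≤ D.ξ P a at hlo
  change D.ξ P a + 2 * P.ε + 4 * P.sA < 0 at hhi
  have hε : (0 : ℤ) ≤ P.ε := by positivity
  have htop := hD.ξ_top hV a
  by_cases hi : R.i' D a = ts e
  · have e1 : γ P tc R e = κ' P D R a + (tr P tc R e - D.ξ P a) := by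
      unfold γ κ'; rw [← hi]; unfold rotKey; ring
    rw [e1]
    have hia : D.i a = R.as e := by
      unfold Route.i' at hi; unfold Route.as
      have h3 := hD.hi a; have hr := hR.hr; have := ts_lt e
      omega
    have h' := htgt.out a
    have htr : tr P tc R e = P.tgtRow4 (tc (D.i a)) := by unfold tr; rw [hia]
    rw [← htr] at h'
    have hd0 : (0 : ℤ) ≤ ((P.N' / 64 : ℕ) : ℤ) := by positivity
    rcases h' with h' | h'
    · left; linarith
    · right; linarith
  · -- different blocks
    have ka : 2 * (P.M : ℤ) * (R.i' D a) + 2 * P.sA ≤ κ' P D R a ∧ κ' P D R a + 4 * P.sA < 2 * (P.M : ℤ) * (R.i' D a + 1) := by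
      unfold κ' rotKey; constructor <;> linarith
    have hM : (0 : ℤ) ≤ P.M := by positivity
    rcases Nat.lt_or_gt_of_ne hi with h | h
    · left; have : (R.i' D a : ℤ) + 1 ≤ ts e := by exact_mod_cast h
      nlinarith
    · right; have : (ts e : ℤ) + 1 ≤ R.i' D a := by exact_mod_cast h
      nlinarith

/-- **No exit reads like a target** from the cut. [folklore] -/
theorem Tq_ne_Gq (hV : P.ValidA) (hD : D.Good P) (hR : R.Good P D) (htc : ∀ s, tc s < 5) (htgt : D.TgtOK P tc)
    (q q' : Fin 4) : Tq P D R q ≠ Gq P tc R q' := by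
  intro h
  unfold Tq Gq at h
  have hs1 : (1 : ℤ) ≤ P.sA := by have := hV.sA_facts.2; omega
  have hM : (0 : ℤ) ≤ P.M := by positivity
  have kr : 0 ≤ κ' P D R q ∧ κ' P D R q < 12 * P.M := by
    obtain ⟨-, -, hlo, hhi, -⟩ := hD.obj_ok hV le_rfl q
    change -(2 * (P.M : ℤ)) + 2 * P.sA ≤ D.ξ P q at hlo
    change D.ξ P q + 2 * P.ε + 4 * P.sA < 0 at hhi
    have hε : (0 : ℤ) ≤ P.ε := by positivity
    have hi6 : (R.i' D q : ℤ) ≤ 5 := by have := R.i'_lt D q; omega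
    have hi0 : (0 : ℤ) ≤ R.i' D q := by positivity
    unfold κ' rotKey; constructor <;> nlinarith
  have gr : 0 ≤ γ P tc R q' ∧ γ P tc R q' < 12 * P.M := by
    obtain ⟨-, -, -, -, -, -, g1, g2, -⟩ := tgt_facts (R := R) hV htc q'
    have h6 : (ts q' : ℤ) ≤ 5 := by have := ts_lt q'; omega
    have h0 : (0 : ℤ) ≤ ts q' := by positivity
    have hs0 : (0 : ℤ) ≤ P.sA := by positivity
    constructor <;> nlinarith
  have heq := eq_of_cyc_eq kr gr h
  rcases κγ_far hV hD hR htc htgt q q' with h' | h' <;> linarith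

/-- **The hull facts of the exit `e`**: the cut position and the hull ends are positions of the ring, and
the hull contains the read windows of the exit's own spoke and target. [folklore] -/
theorem hull_facts (hV : P.ValidA) (hD : D.Good P) (hR : R.Good P D) (e : Fin 4) :
    pc P D tc R δ e < GE P D tc R e ∧ hs P D tc R δ e ≤ he P D tc R δ e ∧ he P D tc R δ e < GE P D tc R e ∧
      hs P D tc R δ e ≤ lp P D tc R δ e ((X P D R δ e).rwlo (nE P D tc R e) P.sA (rE P D tc R e)) ∧
      lp P D tc R δ e ((X P D R δ e).rwhi (nE P D tc R e) P.sA (rE P D tc R e)) ≤ he P D tc R δ e ∧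
      hs P D tc R δ e ≤ lp P D tc R δ e ((Y P tc R δ e).rwlo (nE P D tc R e) P.sA (rE P D tc R e)) ∧
      lp P D tc R δ e ((Y P tc R δ e).rwhi (nE P D tc R e) P.sA (rE P D tc R e)) ≤ he P D tc R δ e := by
  obtain ⟨hn1, hns, -, hG, -, hs1⟩ := ringE_facts (D := D) (tc := tc) (R := R) hV e
  have hC := C_ok (tc := tc) (R := R) (δ := δ) hV hD e
  have hXe := X_ok (tc := tc) (R := R) (δ := δ) hV hD e e
  obtain ⟨-, -, bc, ec⟩ := RingObj.rwindow_mem_block (n := nE P D tc R e) hC hs1 hns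
  have hpc := (RingObj.rwlo_le_rcutPos (n := nE P D tc R e) hC hs1 hns).2
  have hpcG : pc P D tc R δ e < GE P D tc R e := by unfold pc; rw [hG]; omega
  obtain ⟨-, wx, -, -⟩ := RingObj.rwindow_mem_block (n := nE P D tc R e) hXe hs1 hns
  have wX := RingObj.linPos_rwindow (n := nE P D tc R e) hXe hC hs1 hns (X_cut (R := R) (δ := δ) hV hD hR e) ⟨le_rfl, wx⟩
  have hGpos : 0 < GE P D tc R e := by omega
  refine ⟨hpcG, ?_, ?_, min_le_left _ _, le_max_left _ _, min_le_right _ _, le_max_right _ _⟩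
  · calc hs P D tc R δ e ≤ lp P D tc R δ e ((X P D R δ e).rwlo (nE P D tc R e) P.sA (rE P D tc R e)) := min_le_left _ _
      _ ≤ lp P D tc R δ e ((X P D R δ e).rwhi (nE P D tc R e) P.sA (rE P D tc R e)) := by
          unfold lp GE OParams.GrA; unfold nE at wX; exact wX.1.trans wX.2
      _ ≤ he P D tc R δ e := le_max_left _ _
  · unfold he lp linPos
    exact max_lt (Nat.mod_lt _ hGpos) (Nat.mod_lt _ hGpos)

/-- **The exclusion lemma.** For distinct exits `e`, `b` (of either colour — in the adjacent arrangement
the two corridors of one colour must be disjoint too): if the ring of `b` is higher,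
every position of the spoke window of `b` on the ring of `e` reads outside the hull of `e`; if it is
lower, every position of the approach window of `b` on the ring of `e` reads outside the hull of `e`
(`Lanes.lanes_linear` and `RingObj.rot_linPos_lt_of_cyc_lt`). [cite: Nolin2008, §4.3 Prop. 12 (i), Lemma 13 (arXiv 0711.4948: Prop. 11, Lemma 12)] -/
theorem excl (hV : P.ValidA) (hD : D.Good P) (htc : ∀ s, tc s < 5) (htgt : D.TgtOK P tc) (hR : R.Good P D)
    {e b : Fin 4} (heb : e ≠ b) :
    (lv P D tc R e < lv P D tc R b → ∀ p, (X P D R δ b).rwlo (nE P D tc R e) P.sA (rE P D tc R e) ≤ p →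
      p ≤ (X P D R δ b).rwhi (nE P D tc R e) P.sA (rE P D tc R e) → lp P D tc R δ e p < hs P D tc R δ e ∨ he P D tc R δ e < lp P D tc R δ e p) ∧
    (lv P D tc R b < lv P D tc R e → ∀ p, (Y P tc R δ b).rwlo (nE P D tc R e) P.sA (rE P D tc R e) ≤ p →
      p ≤ (Y P tc R δ b).rwhi (nE P D tc R e) P.sA (rE P D tc R e) → lp P D tc R δ e p < hs P D tc R δ e ∨ he P D tc R δ e < lp P D tc R δ e p) := by
  have hT : StrictMono (Tq P D R) := strictMono_four' hR.hτ.1 hR.hτ.2.1 hR.hτ.2.2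
  obtain ⟨hγ, -⟩ := hR.hγ (tc := tc) hV htc
  have hG : StrictMono (Gq P tc R) := strictMono_four' hγ.1 hγ.2.1 hγ.2.2
  obtain ⟨l1, l2⟩ := lanes_linear hT hG (Tq_ne_Gq hV hD hR htc htgt) heb
  change (lv P D tc R e < lv P D tc R b → cyc (12 * P.M) R.c (κ' P D R b) < min (cyc (12 * P.M) R.c (κ' P D R e)) (cyc (12 * P.M) R.c (γ P tc R e)) ∨
    max (cyc (12 * P.M) R.c (κ' P D R e)) (cyc (12 * P.M) R.c (γ P tc R e)) < cyc (12 * P.M) R.c (κ' P D R b)) at l1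
  change (lv P D tc R b < lv P D tc R e → cyc (12 * P.M) R.c (γ P tc R b) < min (cyc (12 * P.M) R.c (κ' P D R e)) (cyc (12 * P.M) R.c (γ P tc R e)) ∨
    max (cyc (12 * P.M) R.c (κ' P D R e)) (cyc (12 * P.M) R.c (γ P tc R e)) < cyc (12 * P.M) R.c (γ P tc R b)) at l2
  -- ring data
  obtain ⟨hn1, hns, -, hGE, -, hs1⟩ := ringE_facts (D := D) (tc := tc) (R := R) hV e
  have hC := C_ok (tc := tc) (R := R) (δ := δ) hV hD e
  have hXe := X_ok (tc := tc) (R := R) (δ := δ) hV hD e e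
  have hXb := X_ok (tc := tc) (R := R) (δ := δ) hV hD b e
  have hYe := Y_ok (D := D) (R := R) (δ := δ) hV htc e e
  have hYb := Y_ok (D := D) (R := R) (δ := δ) hV htc b e
  have cXe := X_cut (R := R) (δ := δ) hV hD hR e
  have cXb := X_cut (R := R) (δ := δ) hV hD hR b
  have cYe := Y_cut (R := R) (δ := δ) hV hD hR htc htgt e
  have cYb := Y_cut (R := R) (δ := δ) hV hD hR htc htgt b
  have ρX : ∀ a, (X P D R δ a).lo ≤ D.ξ P a ∧ D.ξ P a ≤ (X P D R δ a).hi := fun a =>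
    ⟨by show D.ξ P a - P.sA ≤ D.ξ P a; linarith [(show (0 : ℤ) ≤ P.sA by positivity)], le_rfl⟩
  have ρY : ∀ e', (Y P tc R δ e').lo ≤ tr P tc R e' ∧ tr P tc R e' ≤ (Y P tc R δ e').hi := fun e' =>
    ⟨by show tr P tc R e' - P.sA ≤ tr P tc R e'; linarith [(show (0 : ℤ) ≤ P.sA by positivity)],
      by show tr P tc R e' ≤ tr P tc R e' + _; exact le_add_of_nonneg_right (by positivity)⟩
  have hM : (0 : ℤ) ≤ P.M := by positivity
  have hs0 : (0 : ℤ) ≤ P.sA := by positivity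
  have hε : (0 : ℤ) ≤ P.ε := by positivity
  -- keys read after `δ` more rotations are the shifted keys
  have hM1 : 1 ≤ P.M := by
    have h1 : 64 * P.μ ≤ P.M := hV.toValid.hμM
    have h2 : P.k₀ ≤ P.μ := le_trapScale P.k₀ P.K
    have h3 := hV.toValid.hk₀; omega
  have hd0 : 0 ≤ (2 * P.M * (δ % 6 : ℕ) : ℤ) ∧ (2 * P.M * (δ % 6 : ℕ) : ℤ) < 12 * P.M := by
    have h6 := Nat.mod_lt δ (show 0 < 6 by norm_num)
    constructor
    · positivity
    · have : ((δ % 6 : ℕ) : ℤ) ≤ 5 := by omega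
      nlinarith
  have kr : ∀ a, 0 ≤ κ' P D R a ∧ κ' P D R a < 12 * P.M := fun a => by
    obtain ⟨-, -, hlo, hhi, -⟩ := hD.obj_ok hV le_rfl a
    change -(2 * (P.M : ℤ)) + 2 * P.sA ≤ D.ξ P a at hlo
    change D.ξ P a + 2 * P.ε + 4 * P.sA < 0 at hhi
    have hi6 : (R.i' D a : ℤ) ≤ 5 := by have := R.i'_lt D a; omega
    have hi0 : (0 : ℤ) ≤ R.i' D a := by positivity
    unfold κ' rotKey; constructor <;> nlinarith
  have gr : ∀ e', 0 ≤ γ P tc R e' ∧ γ P tc R e' < 12 * P.M := fun e' => by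
    obtain ⟨-, -, -, -, -, -, g1, g2, -⟩ := tgt_facts (R := R) hV htc e'
    have h6 : (ts e' : ℤ) ≤ 5 := by have := ts_lt e'; omega
    have h0 : (0 : ℤ) ≤ ts e' := by positivity
    constructor <;> nlinarith
  have eX0 : ∀ a, rotKey P.M (X P D R δ a).fr (D.ξ P a) = shd P.M (2 * P.M * (δ % 6 : ℕ)) (κ' P D R a) := fun a => by
    obtain ⟨-, -, hlo, hhi, -⟩ := hD.obj_ok hV le_rfl a
    change -(2 * (P.M : ℤ)) + 2 * P.sA ≤ D.ξ P a at hlo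
    change D.ξ P a + 2 * P.ε + 4 * P.sA < 0 at hhi
    show rotKey P.M (sft δ (R.i' D a)) (D.ξ P a) = _
    rw [rotKey_sft (R.i'_lt D a) ⟨by linarith, by linarith⟩]; push_cast; rfl
  have eY0 : ∀ e', rotKey P.M (Y P tc R δ e').fr (tr P tc R e') = shd P.M (2 * P.M * (δ % 6 : ℕ)) (γ P tc R e') := fun e' => by
    obtain ⟨-, -, -, -, t1, t2, -⟩ := tgt_facts (R := R) hV htc e'
    have hd : (0 : ℤ) ≤ ((P.dA - 1 : ℕ) : ℤ) * P.sA := by positivity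
    show rotKey P.M (sft δ (ts e')) (tr P tc R e') = _
    rw [rotKey_sft (ts_lt e') ⟨by linarith, by nlinarith [hs1]⟩]; push_cast; rfl
  have kC : rotKey P.M (C P D R δ).fr (C P D R δ).lo = shd P.M (2 * P.M * (δ % 6 : ℕ)) R.c := by
    obtain ⟨-, -, clo, chi, -⟩ := hC
    change -(2 * (P.M : ℤ)) + 2 * P.sA ≤ ρC P D at clo
    change ρC P D + 4 * P.sA < 0 at chi
    show rotKey P.M (sft δ (R.i' D 3)) (ρC P D) = _
    rw [rotKey_sft (R.i'_lt D 3) ⟨by linarith, by linarith⟩, ← hR.hc]; push_cast; rfl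
  have eX : ∀ a, cyc (12 * P.M) (rotKey P.M (C P D R δ).fr (C P D R δ).lo) (rotKey P.M (X P D R δ a).fr (D.ξ P a)) = Tq P D R a :=
    fun a => by rw [kC, eX0]; exact cyc_shd hd0 (kr a) hR.hc_range
  have eY : ∀ e', cyc (12 * P.M) (rotKey P.M (C P D R δ).fr (C P D R δ).lo) (rotKey P.M (Y P tc R δ e').fr (tr P tc R e')) = Gq P tc R e' :=
    fun e' => by rw [kC, eY0]; exact cyc_shd hd0 (gr e') hR.hc_range
  have kP : ∀ a, rotKey P.M (X P D R δ a).fr (D.ξ P a) < 12 * P.M := fun a => by rw [eX0]; exact (shd_range hd0 (kr a)).2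
  have gP : ∀ e', rotKey P.M (Y P tc R δ e').fr (tr P tc R e') < 12 * P.M := fun e' => by rw [eY0]; exact (shd_range hd0 (gr e')).2
  have wXb := fun p (hp : (X P D R δ b).rwlo (nE P D tc R e) P.sA (rE P D tc R e) ≤ p ∧ p ≤ (X P D R δ b).rwhi (nE P D tc R e) P.sA (rE P D tc R e)) =>
    RingObj.linPos_rwindow (n := nE P D tc R e) hXb hC hs1 hns cXb hp
  have wYb := fun p (hp : (Y P tc R δ b).rwlo (nE P D tc R e) P.sA (rE P D tc R e) ≤ p ∧ p ≤ (Y P tc R δ b).rwhi (nE P D tc R e) P.sA (rE P D tc R e)) =>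
    RingObj.linPos_rwindow (n := nE P D tc R e) hYb hC hs1 hns cYb hp
  -- the generic step
  have step := fun {A B : RingObj} (hA : A.OK P.sA (rE P D tc R e) P.M) (hB : B.OK P.sA (rE P D tc R e) P.M)
      (hsep : RingObj.Sep P.sA A B) (cA : RingObj.RBefore 2 P.sA A (C P D R δ) ∨ RingObj.RBefore 2 P.sA (C P D R δ) A)
      (cB : RingObj.RBefore 2 P.sA B (C P D R δ) ∨ RingObj.RBefore 2 P.sA (C P D R δ) B) {ρA ρB : ℤ}
      (hρA : A.lo ≤ ρA ∧ ρA ≤ A.hi) (hρB : B.lo ≤ ρB ∧ ρB ≤ B.hi) (hPB : rotKey P.M B.fr ρB < 12 * P.M)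
      (hlt : cyc (12 * P.M) (rotKey P.M (C P D R δ).fr (C P D R δ).lo) (rotKey P.M A.fr ρA) <
        cyc (12 * P.M) (rotKey P.M (C P D R δ).fr (C P D R δ).lo) (rotKey P.M B.fr ρB)) =>
    RingObj.rot_linPos_lt_of_cyc_lt (n := nE P D tc R e) hA hB hC hs1 hns hsep cA cB hρA hρB hPB hlt
  unfold lp hs he GE OParams.GrA
  unfold nE at wXb wYb ⊢
  constructor
  · intro hl p hp1 hp2
    have w := wXb p ⟨hp1, hp2⟩
    rcases l1 hl with h | h
    · left
      obtain ⟨h1, h2⟩ := lt_min_iff.1 h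
      have w1 := step hXb hXe (sep_XX hV hD hR (Ne.symm heb)) cXb cXe (ρX _) (ρX _) (kP _) (by rw [eX, eX]; exact h1)
      have w2 := step hXb hYe (sep_XY hV hD hR htc htgt _ _) cXb cYe (ρX _) (ρY _) (gP _) (by rw [eX, eY]; exact h2)
      exact lt_of_le_of_lt w.2 (lt_min w1 w2)
    · right
      obtain ⟨h1, h2⟩ := max_lt_iff.1 h
      have w1 := step hXe hXb (sep_XX hV hD hR heb) cXe cXb (ρX _) (ρX _) (kP _) (by rw [eX, eX]; exact h1)
      have w2 := step hYe hXb (rsep_symm (sep_XY hV hD hR htc htgt _ _)) cYe cXb (ρY _) (ρX _) (kP _) (by rw [eY, eX]; exact h2)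
      exact lt_of_lt_of_le (max_lt w1 w2) w.1
  · intro hl p hp1 hp2
    have w := wYb p ⟨hp1, hp2⟩
    rcases l2 hl with h | h
    · left
      obtain ⟨h1, h2⟩ := lt_min_iff.1 h
      have w1 := step hYb hXe (rsep_symm (sep_XY hV hD hR htc htgt _ _)) cYb cXe (ρY _) (ρX _) (kP _) (by rw [eY, eX]; exact h1)
      have w2 := step hYb hYe (sep_YY (Ne.symm heb)) cYb cYe (ρY _) (ρY _) (gP _) (by rw [eY, eY]; exact h2)
      exact lt_of_le_of_lt w.2 (lt_min w1 w2)
    · right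
      obtain ⟨h1, h2⟩ := max_lt_iff.1 h
      have w1 := step hXe hYb (sep_XY hV hD hR htc htgt _ _) cXe cYb (ρX _) (ρY _) (gP _) (by rw [eX, eY]; exact h1)
      have w2 := step hYe hYb (sep_YY heb) cYe cYb (ρY _) (ρY _) (gP _) (by rw [eY, eY]; exact h2)
      exact lt_of_lt_of_le (max_lt w1 w2) w.1

end AdjTipData

end Literature.Probability.Percolation
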